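import Literature.MathematicalPhysics.QuantumFieldTheory.Balaban1983to89.Node00.TorusCoverSUGauge
import Literature.MathematicalPhysics.QuantumFieldTheory.Balaban1983to89.Node00.TorusCoverCubeMember

/-!
# NODE 00 — THE TORUS→`ℤᵈ` TWIN, FILE 4a: READING [6] PROPOSITION 6's CONCLUSION `Node00.GaugedBoundB8` ON THE CUBE `□ = box L a M k` FOR AN
# `SU(N)`-VALUED CONFIGURATION — the unitary gauge `w = v⁻¹u` of (1.135) is normalised to an `SU(N)`-valued gauge `s` (FILE 3b) and the exponent read as
# two letters: `V^{s} = e^{iηÃ}` on the bonds of `□` with `‖Ã‖ ≤ 2r(Lᵏη)⁻¹` ((1.136)₁) and `‖Ã(x+e_μ, ν) − Ã(x, ν)‖ ≤ 2ηr(Lᵏη)⁻²` ((1.136)₂, the gradient member)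

Cell `pub-ymgap`, seat `pub-ymgap-dag-n07-e` generation 10 (R141 (C) s3 «torus-vs-box twin», DAG node N07 = [15]; INTENT-25 programme FILE 28a, bus 2026-08-27).
NEW leaf; CONSUMED BY NAME, nothing modified: node00-def-cube's `Node00.CubeB8 ∕ GaugedBoundB8` (the letters of the Proposition-6 slot of record), n05-a's
`B8Eq131Cubes.(box, cube, tcube, …)`, `B8Eq131CubesAdmissible.cubeFam(_of_pos)`, `B8LeafModelZd3.mlogCfg(_of_sideTouches, _of_not)`, `B8Eq140Level.SideTouches
(sideTouches_of_bondTouches)`, lit-balaban's `B8ScaledSupNorm.(msup, Bdd, weight, norm_le_of_msup_le)`, `B8Ineq132.covDerivFwd`, `B8Eq138LandauZd.logCfg`,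
`B8Eq184Proof.cfgExp`, this seat's FILE 2 `box_subset_tcube_of_le` (p539532) and FILE 3b `exists_suGauge_of_unitaryGauge`, `traceless`, `norm_traceless(_sub)_le`.
`--kind definition --supports stmt-QuantumFields-20506` (K0⁶, WORDS-142).
[15] = [Balaban1985Variational]; [6] = [Balaban1985RegularSpaces]; [3] = [Balaban1985Averaging].

WHY.  `Node00.GaugedBoundB8 L η U₀ c r` is (1.135)–(1.138) of [6] Prop. 6 with the number `r`: a unitary `u`, `= 1` off `□₀`, the Landau gauge, `U₁ = U₀″^{u⁻¹} =
e^{iηA}` with `A` self-adjoint and `Lʲη|A| ≤ r` on the sides touching `□_j` ((1.136)₁), `w = v⁻¹u` unitary with `U₀^{w⁻¹} = U₁` on the bonds of `□̃` ((1.135)),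
the scaled sup norm `|∇A|_(−2) ≤ r` of the masked exponent ((1.136)₂) and the two third-order members.  The torus token `Gauge152OfClassTopStep` wants, on the
cube: an `SU(N)`-valued gauge, `(ιU)^{ιu} = expI η A′` bondwise, `‖A′‖` and the forward differences `‖A′(x+e_μ, ν) − A′(x, ν)‖` small.  THIS FILE reads the former
as the latter ON THE COVER, for an `SU(N)`-valued `U₀ = V` (every lift `zdLift N U` is): (i) the bonds and derivative quadruples INSIDE `□ = box L c.a c.M c.k` touch
`□_k ⊇ □` (n05-a's `box_subset_cube_top`), so (1.136)₁ reads `‖A‖ ≤ r(Lᵏη)⁻¹` there and the masked exponent IS `A` there; (ii) the scaled-sup family of (1.136)₂ is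
BOUNDED (`B8ScaledSupNorm.Bdd`, from (1.136)₁ on every side — the masked logarithm vanishes elsewhere), so `|∇A|_(−2) ≤ r` reads pointwise
`‖A(x+e_μ,ν) − A(x,ν)‖ ≤ ηr(Lᵏη)⁻²` on the quadruples inside `□`; (iii) FILE 3b normalises `w⁻¹` to an `SU(N)`-valued `s` at the price `A ↦ Ã = A − (Re tr A∕N)·1`,
which at most doubles both letters.  FILE 4b pushes `s`, `Ã` down to the torus through the cover.

WHAT IS PROVED (kernel; `𝔸 = M_N(ℂ)`, `N ≥ 1`, `d ≥ 2`, `L ≥ 2`; NO estimate of Bałaban — the letters of `GaugedBoundB8` are READ, not proved).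
`exists_ne_fin` · `sideTouches_sq_top_of_mem_box` (a bond inside `□` is a side touching `□_k`) · `mlogCfg_eq_logCfg_of_mem_box` · `norm_mlogCfg_le_of_sides` (the masked
exponent is bounded by `r·η⁻¹` everywhere, given (1.136)₁ on all sides) · `bdd_gradFamily_of_sides` (the (1.136)₂ family is `Bdd`) · `norm_sub_le_of_msup_grad` (pointwise
reading of `|∇A|_(−2) ≤ r` inside `□`) · ★★★ `exists_suGauge_letters_of_gaugedBoundB8` (from `GaugedBoundB8 L η V c r`, `V` `SU(N)`-valued, `(2W+1)·ηN·r(Lᵏη)⁻¹ < 2π`: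
`∃ s Ã`, `V^{ιSU∘s} = cfgExp η Ã` on the bonds of `□`, `‖Ã‖ ≤ 2r(Lᵏη)⁻¹` there, `‖Ã(x+e_μ,ν) − Ã(x,ν)‖ ≤ 2ηr((Lᵏη)²)⁻¹` on the quadruples inside `□`).
HONEST FRAMING: bookkeeping on the letters of the Proposition-6 slot; nothing of Bałaban asserted or discharged; N07 ∕ N05 ∕ K0⁶ NOT discharged; counts unmoved (5∕27);
one finite T⁴ programme at fixed ε — NOT continuum ∕ ℝ⁴ ∕ infinite volume ∕ OS ∕ mass gap ∕ Clay.  No `sorry`, no `instance`, no `notation`.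
-/

noncomputable section

namespace Literature.MathematicalPhysics.QuantumFieldTheory.Balaban1983to89.Node00

open scoped Matrix.Norms.L2Operator
open Complex (I)
open B7Prop1Explicit (e e_apply)
open B7Prop1Local (InBox AgreeOn)
open B7Prop2Explicit (unitaryUnits mem_unitaryUnits)
open B7Prop2SpecialUnitary (specialUnitaryUnits mem_specialUnitaryUnits)
open B7Eq78Linearization (conjR conjR_apply)
open B8Ineq130 (tlo thi)
open B8Ineq132 (covDerivFwd BondTouches)
open B8Eq131Cubes (box cube tcube tLo tHi bLo bHi box_subset_cube_top)
open B8Eq131CubesAdmissible (cubeFam cubeFam_of_pos)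
open B8Eq140Level (SideTouches sideTouches_of_bondTouches)
open B8Eq138LandauZd (logCfg)
open B8Eq184Proof (cfgExp)
open B8LeafModelZd3 (mlogCfg mlogCfg_of_sideTouches mlogCfg_of_not)
open B8ScaledSupNorm (msup Bdd weight norm_le_of_msup_le)

variable {d N : ℕ} [NeZero N]

/-- In `d ≥ 2` dimensions every direction has a different one. [folklore] -/
private theorem exists_ne_fin (hd : 2 ≤ d) (μ : Fin d) : ∃ κ : Fin d, κ ≠ μ := by
  haveI : Nontrivial (Fin d) := Fin.nontrivial_iff_two_le.2 hd
  exact exists_ne μ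

section Letters

variable {L K : ℕ} {Ω : ℕ → Set (B7Prop1Explicit.Site d)} (c : CubeB8 d L K Ω)

/-- **A bond inside `□` is a side touching `□_k`** (`□ ⊂ □_k`, [6] (1.131) «□_{k+1} = □»; the p. 77 side convention needs a second direction, `d ≥ 2`).
[cite: Balaban1985RegularSpaces, (1.131) p.99, p.77 (convention before (1.5))] -/
theorem sideTouches_sq_top_of_mem_box (hd : 2 ≤ d) {x : B7Prop1Explicit.Site d} (hx : x ∈ box L c.a c.M c.k) (μ : Fin d) : SideTouches (c.sq c.k) x μ := by
  obtain ⟨κ, hκ⟩ := exists_ne_fin hd μ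
  have hsq : c.sq c.k = cube L c.a c.M c.ρ c.k c.k := cubeFam_of_pos false L c.a c.M c.ρ c.one_le_k le_rfl
  rw [hsq]
  exact sideTouches_of_bondTouches hκ (Or.inl (box_subset_cube_top L c.a c.M c.ρ c.k hx))

variable {𝔸 : Type*} [CStarAlgebra 𝔸]

/-- On a bond inside `□` the masked exponent of record IS the logarithm ((1.136)'s `A = (1/iη) log U₁` there). [cite: Balaban1985RegularSpaces, (1.135)–(1.136) p.99] -/
theorem mlogCfg_eq_logCfg_of_mem_box (hd : 2 ≤ d) (η : ℝ) (U₁ : B7Prop1Explicit.Site d → Fin d → 𝔸ˣ) {x : B7Prop1Explicit.Site d}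
    (hx : x ∈ box L c.a c.M c.k) (μ : Fin d) : mlogCfg c.k η c.sq U₁ x μ = logCfg η U₁ x μ :=
  mlogCfg_of_sideTouches η U₁ le_rfl (sideTouches_sq_top_of_mem_box c hd hx μ)

/-- **THE MASKED EXPONENT IS BOUNDED EVERYWHERE** once (1.136)₁ holds on every side touching some `□_j`: `‖mlogCfg … y τ‖ ≤ r·η⁻¹` (`L ≥ 1`, `η > 0`, `r ≥ 0`; it
vanishes off the sides). [cite: Balaban1985RegularSpaces, (1.136) p.99, p.77 (bond convention)] -/
theorem norm_mlogCfg_le_of_sides (hL : 1 ≤ L) {η r : ℝ} (hη : 0 < η) (hr : 0 ≤ r) (U₁ : B7Prop1Explicit.Site d → Fin d → 𝔸ˣ)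
    (h136 : ∀ j, j ≤ c.k → ∀ b ∈ {b : B7Prop1Explicit.Site d × Fin d | SideTouches (c.sq j) b.1 b.2}, ‖logCfg η U₁ b.1 b.2‖ ≤ r * ((L : ℝ) ^ j * η)⁻¹)
    (y : B7Prop1Explicit.Site d) (τ : Fin d) : ‖mlogCfg c.k η c.sq U₁ y τ‖ ≤ r * η⁻¹ := by
  classical
  by_cases h : ∃ j, j ≤ c.k ∧ SideTouches (c.sq j) y τ
  · obtain ⟨j, hj, hs⟩ := h
    rw [mlogCfg_of_sideTouches η U₁ hj hs]
    refine (h136 j hj (y, τ) hs).trans (mul_le_mul_of_nonneg_left ?_ hr)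
    rw [mul_inv]
    have hLj : (1 : ℝ) ≤ (L : ℝ) ^ j := one_le_pow₀ (by exact_mod_cast hL)
    calc ((L : ℝ) ^ j)⁻¹ * η⁻¹ ≤ 1 * η⁻¹ := mul_le_mul_of_nonneg_right (inv_le_one_of_one_le₀ hLj) (inv_nonneg.2 hη.le)
      _ = η⁻¹ := one_mul _
  · push Not at h
    rw [mlogCfg_of_not η U₁ fun j hj => h j hj, norm_zero]
    positivity

/-- **THE (1.136)₂ FAMILY IS BOUNDED** (`B8ScaledSupNorm.Bdd`): the weights `(Lʲη)²`, `j ≤ k`, are at most `(Lᵏη)²` and the forward differences of the masked exponent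
at background `1` are at most `2rη⁻²`. [cite: Balaban1985RegularSpaces, (1.136) p.99, p.86 (the scaled sup norm)] -/
theorem bdd_gradFamily_of_sides (hL : 1 ≤ L) {η r : ℝ} (hη : 0 < η) (hr : 0 ≤ r) (U₁ : B7Prop1Explicit.Site d → Fin d → 𝔸ˣ)
    (h136 : ∀ j, j ≤ c.k → ∀ b ∈ {b : B7Prop1Explicit.Site d × Fin d | SideTouches (c.sq j) b.1 b.2}, ‖logCfg η U₁ b.1 b.2‖ ≤ r * ((L : ℝ) ^ j * η)⁻¹) :
    Bdd L c.k η (-(2 : ℝ)) (fun j (t : Fin d × Fin d × B7Prop1Explicit.Site d) => SideTouches (c.sq j) t.2.2 t.2.1)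
      (fun t => covDerivFwd η (1 : B7Prop1Explicit.Site d → Fin d → 𝔸ˣ) t.1 (fun z => mlogCfg c.k η c.sq U₁ z t.2.1) t.2.2) := by
  refine ⟨((L : ℝ) ^ c.k * η) ^ (2 : ℝ) * (η⁻¹ * (2 * (r * η⁻¹))), fun j hj t _ => ?_⟩
  have hscale : 0 < (L : ℝ) ^ j * η := B8ScaledSupNorm.scale_pos hL hη j
  have hw : weight L η (-(2 : ℝ)) j ≤ ((L : ℝ) ^ c.k * η) ^ (2 : ℝ) := by
    rw [weight, neg_neg]
    exact Real.rpow_le_rpow hscale.le (mul_le_mul_of_nonneg_right (pow_le_pow_right₀ (by exact_mod_cast hL) hj) hη.le) (by norm_num)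
  have hF : ‖covDerivFwd η (1 : B7Prop1Explicit.Site d → Fin d → 𝔸ˣ) t.1 (fun z => mlogCfg c.k η c.sq U₁ z t.2.1) t.2.2‖ ≤ η⁻¹ * (2 * (r * η⁻¹)) := by
    rw [covDerivFwd, norm_smul, Real.norm_eq_abs, abs_of_pos (inv_pos.2 hη), conjR_apply, Pi.one_apply, Pi.one_apply, Units.val_one, one_mul,
      inv_one, Units.val_one, mul_one]
    refine mul_le_mul_of_nonneg_left ((norm_sub_le _ _).trans ?_) (inv_nonneg.2 hη.le)
    have h1 := norm_mlogCfg_le_of_sides c hL hη hr U₁ h136 (t.2.2 + e t.1) t.2.1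
    have h2 := norm_mlogCfg_le_of_sides c hL hη hr U₁ h136 t.2.2 t.2.1
    linarith
  exact mul_le_mul hw hF (norm_nonneg _) (by positivity)

/-- **`|∇A|_(−2) ≤ r` READ POINTWISE INSIDE `□`**: for a derivative quadruple with `x, x + e_μ ∈ □`, `‖A(x+e_μ, ν) − A(x, ν)‖ ≤ η·r·((Lᵏη)²)⁻¹` (`A = logCfg η U₁`; the
masked exponent is `A` on both bonds). [cite: Balaban1985RegularSpaces, (1.136) p.99 («(Lʲη)²|∇^η A| ≤ …»), p.86] -/
theorem norm_sub_le_of_msup_grad (hd : 2 ≤ d) (hL : 1 ≤ L) {η r : ℝ} (hη : 0 < η) (hr : 0 ≤ r) (U₁ : B7Prop1Explicit.Site d → Fin d → 𝔸ˣ)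
    (h136 : ∀ j, j ≤ c.k → ∀ b ∈ {b : B7Prop1Explicit.Site d × Fin d | SideTouches (c.sq j) b.1 b.2}, ‖logCfg η U₁ b.1 b.2‖ ≤ r * ((L : ℝ) ^ j * η)⁻¹)
    (hgrad : msup L c.k η (-(2 : ℝ)) (fun j (t : Fin d × Fin d × B7Prop1Explicit.Site d) => SideTouches (c.sq j) t.2.2 t.2.1)
      (fun t => covDerivFwd η (1 : B7Prop1Explicit.Site d → Fin d → 𝔸ˣ) t.1 (fun z => mlogCfg c.k η c.sq U₁ z t.2.1) t.2.2) ≤ r)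
    {x : B7Prop1Explicit.Site d} {μ ν : Fin d} (hx : x ∈ box L c.a c.M c.k) (hx' : x + e μ ∈ box L c.a c.M c.k) :
    ‖logCfg η U₁ (x + e μ) ν - logCfg η U₁ x ν‖ ≤ η * r * (((L : ℝ) ^ c.k * η) ^ 2)⁻¹ := by
  have hmem : SideTouches (c.sq c.k) x ν := sideTouches_sq_top_of_mem_box c hd hx ν
  have h := norm_le_of_msup_le (F := fun t : Fin d × Fin d × B7Prop1Explicit.Site d =>
      covDerivFwd η (1 : B7Prop1Explicit.Site d → Fin d → 𝔸ˣ) t.1 (fun z => mlogCfg c.k η c.sq U₁ z t.2.1) t.2.2)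
    (mem := fun j (t : Fin d × Fin d × B7Prop1Explicit.Site d) => SideTouches (c.sq j) t.2.2 t.2.1)
    hL hη (bdd_gradFamily_of_sides c hL hη hr U₁ h136) hgrad le_rfl (i := (μ, ν, x)) hmem
  -- `h : ‖η⁻¹ • (R(1)A(x+e_μ,ν) − A(x,ν))‖ ≤ r·(Lᵏη)^{−2}`
  simp only [covDerivFwd, conjR_apply, Pi.one_apply, Units.val_one, one_mul, inv_one, mul_one,
    mlogCfg_eq_logCfg_of_mem_box c hd η U₁ hx, mlogCfg_eq_logCfg_of_mem_box c hd η U₁ hx'] at h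
  rw [norm_smul, Real.norm_eq_abs, abs_of_pos (inv_pos.2 hη)] at h
  have hscale : 0 < (L : ℝ) ^ c.k * η := B8ScaledSupNorm.scale_pos hL hη c.k
  have hrpow : ((L : ℝ) ^ c.k * η) ^ (-(2 : ℝ)) = (((L : ℝ) ^ c.k * η) ^ 2)⁻¹ := by
    rw [Real.rpow_neg hscale.le, Real.rpow_two]
  rw [hrpow] at h
  calc ‖logCfg η U₁ (x + e μ) ν - logCfg η U₁ x ν‖ = η * (η⁻¹ * ‖logCfg η U₁ (x + e μ) ν - logCfg η U₁ x ν‖) := by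
        rw [← mul_assoc, mul_inv_cancel₀ hη.ne', one_mul]
    _ ≤ η * (r * (((L : ℝ) ^ c.k * η) ^ 2)⁻¹) := mul_le_mul_of_nonneg_left h hη.le
    _ = η * r * (((L : ℝ) ^ c.k * η) ^ 2)⁻¹ := by ring

end Letters

/-! ## The `SU(N)` gauge with its two letters from `GaugedBoundB8` at an `SU(N)`-valued configuration -/

section Assembly

variable {L K : ℕ} {Ω : ℕ → Set (B7Prop1Explicit.Site d)}

/-- ★★★ **[6] PROPOSITION 6's CONCLUSION READ AS AN `SU(N)` GAUGE WITH TWO LETTERS ON `□`.**  Let `V` be `SU(N)`-valued on `ℤᵈ` (units of `M_N(ℂ)` in b07's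
`specialUnitaryUnits`), `c` a cube datum (`1 ≤ k`, side `M`, corner `a`), `L ≥ 2`, `d ≥ 2`, `η > 0`, `r ≥ 0`, and `Node00.GaugedBoundB8 L η V c r` ((1.135)–(1.138) with
the number `r`).  If `(2W + 1)·ηN·r(Lᵏη)⁻¹ < 2π` (`W` the total width of `□ = box L a M k`), then there are an `SU(N)`-valued gauge `s` and an exponent `Ã` with
`V^{ιSU ∘ s}(x, x+e_μ) = e^{iηÃ(x,μ)}` on the bonds of `□`, `‖Ã(x, μ)‖ ≤ 2r(Lᵏη)⁻¹` there, and `‖Ã(x+e_μ, ν) − Ã(x, ν)‖ ≤ 2ηr((Lᵏη)²)⁻¹` whenever `x, x+e_μ, x+e_ν ∈ □`.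
(`s` = FILE 3b's normalisation of `w⁻¹ = (v⁻¹u)⁻¹`, `Ã` = the traceless part of (1.136)'s `A`.) [cite: Balaban1985RegularSpaces, Prop. 6 (1.135)–(1.136) p.99, Thm 2 (1.36) pp.82–83; Balaban1985Variational, (152) p.301] -/
theorem exists_suGauge_letters_of_gaugedBoundB8 (hd : 2 ≤ d) (hL : 2 ≤ L) (c : CubeB8 d L K Ω)
    (V : B7Prop1Explicit.Site d → Fin d → (MatA N)ˣ) (hV : ∀ x μ, V x μ ∈ specialUnitaryUnits (Fin N)) {η r : ℝ} (hη : 0 < η) (hr : 0 ≤ r)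
    (hG : letI : CStarAlgebra (MatA N) := {}; GaugedBoundB8 L η V c r)
    (hsmall : (2 * boxWidth (bLo L c.a c.k 0) (bHi L c.a c.M c.k 0) + 1) * (η * N * (r * ((L : ℝ) ^ c.k * η)⁻¹)) < 2 * Real.pi) :
    ∃ s : B7Prop1Explicit.Site d → Matrix.specialUnitaryGroup (Fin N) ℂ, ∃ A' : B7Prop1Explicit.Site d → Fin d → MatA N,
      (∀ x μ, x ∈ box L c.a c.M c.k → x + e μ ∈ box L c.a c.M c.k →
          B7Prop1Explicit.gaugeAct (fun y => ιSU N (s y)) V x μ = cfgExp η A' x μ) ∧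
      (∀ x μ, x ∈ box L c.a c.M c.k → x + e μ ∈ box L c.a c.M c.k → ‖A' x μ‖ ≤ 2 * (r * ((L : ℝ) ^ c.k * η)⁻¹)) ∧
      (∀ x μ ν, x ∈ box L c.a c.M c.k → x + e μ ∈ box L c.a c.M c.k → x + e ν ∈ box L c.a c.M c.k →
          ‖A' (x + e μ) ν - A' x ν‖ ≤ 2 * (η * r * (((L : ℝ) ^ c.k * η) ^ 2)⁻¹)) := by
  letI : CStarAlgebra (MatA N) := {}
  have hL1 : 1 ≤ L := le_trans (by norm_num) hL
  obtain ⟨u, hu, -, -, -, h162, hw, h135, h136₂, -, -, -⟩ := hG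
  -- the unitary gauge `g = w⁻¹`, `w = v⁻¹u`, with `V^{g} = U₁` on the bonds of `□̃ ⊇ □`
  set w : B7Prop1Explicit.Site d → (MatA N)ˣ := (c.vfix V)⁻¹ * u with hwdef
  set U₁ : B7Prop1Explicit.Site d → Fin d → (MatA N)ˣ := c.fixed V u with hU₁
  have hg : ∀ x, InBox (bLo L c.a c.k 0) (bHi L c.a c.M c.k 0) x → w⁻¹ x ∈ unitaryUnits (MatA N) := fun x _ => by
    rw [Pi.inv_apply]; exact (unitaryUnits (MatA N)).inv_mem (hw x)
  have hboxT : box L c.a c.M c.k ⊆ tcube L c.a c.M c.ρ c.k := box_subset_tcube_of_le L c.a le_rfl c.ρ c.k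
  have h136' : ∀ j, j ≤ c.k → ∀ b ∈ {b : B7Prop1Explicit.Site d × Fin d | SideTouches (c.sq j) b.1 b.2},
      ‖logCfg η U₁ b.1 b.2‖ ≤ r * ((L : ℝ) ^ j * η)⁻¹ := fun j hj b hb => (h162 j hj b hb).2.2
  have hgauge : ∀ x μ, InBox (bLo L c.a c.k 0) (bHi L c.a c.M c.k 0) x → InBox (bLo L c.a c.k 0) (bHi L c.a c.M c.k 0) (x + e μ) →
      B7Prop1Explicit.gaugeAct w⁻¹ V x μ = cfgExp η (logCfg η U₁) x μ := by
    intro x μ hx hx'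
    rw [h135 x μ (hboxT hx) (hboxT hx')]
    exact (h162 c.k le_rfl (x, μ) (sideTouches_sq_top_of_mem_box c hd hx μ)).1
  have hsa : ∀ x μ, InBox (bLo L c.a c.k 0) (bHi L c.a c.M c.k 0) x → InBox (bLo L c.a c.k 0) (bHi L c.a c.M c.k 0) (x + e μ) →
      IsSelfAdjoint (logCfg η U₁ x μ) := fun x μ hx _ => (h162 c.k le_rfl (x, μ) (sideTouches_sq_top_of_mem_box c hd hx μ)).2.1
  have hA : ∀ x μ, InBox (bLo L c.a c.k 0) (bHi L c.a c.M c.k 0) x → InBox (bLo L c.a c.k 0) (bHi L c.a c.M c.k 0) (x + e μ) →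
      ‖logCfg η U₁ x μ‖ ≤ r * ((L : ℝ) ^ c.k * η)⁻¹ := fun x μ hx _ => h136' c.k le_rfl (x, μ) (sideTouches_sq_top_of_mem_box c hd hx μ)
  have hVdet : ∀ x μ, InBox (bLo L c.a c.k 0) (bHi L c.a c.M c.k 0) x → InBox (bLo L c.a c.k 0) (bHi L c.a c.M c.k 0) (x + e μ) →
      ((V x μ : (MatA N)ˣ) : MatA N).det = 1 := fun x μ _ _ => (Matrix.mem_specialUnitaryGroup_iff.1 (hV x μ)).2
  have hr₀ : 0 ≤ r * ((L : ℝ) ^ c.k * η)⁻¹ := mul_nonneg hr (inv_nonneg.2 (B8ScaledSupNorm.scale_pos hL1 hη c.k).le)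
  obtain ⟨s, hs⟩ := exists_suGauge_of_unitaryGauge (bLo L c.a c.k 0) (bHi L c.a c.M c.k 0) hη.le V w⁻¹ (logCfg η U₁) hr₀ hVdet hg hgauge hsa hA hsmall
  refine ⟨s, fun y ν => traceless (logCfg η U₁ y ν), fun x μ hx hx' => hs x μ hx hx', fun x μ hx hx' => ?_, fun x μ ν hx hx' _ => ?_⟩
  · exact (norm_traceless_le _).trans (mul_le_mul_of_nonneg_left (hA x μ hx hx') (by norm_num))
  · exact (norm_traceless_sub_le _ _).trans
      (mul_le_mul_of_nonneg_left (norm_sub_le_of_msup_grad c hd hL1 hη hr U₁ h136' h136₂ hx hx') (by norm_num))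

end Assembly

end Literature.MathematicalPhysics.QuantumFieldTheory.Balaban1983to89.Node00

end
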